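import Summits.QuantumFields.YangMills.Theorems.UnitScaleTiltProp7FirstVariationMultiplier
import Summits.QuantumFields.YangMills.Theorems.UnitScaleTiltProp7FirstVariationLog
import HarnessLib

/-!
# Route `UnitScaleTilt`, crux K1 child «MinimiserStabilityRegPr» (stmt-QuantumFields-19200) — «blend-ℓ²» line (OWNER RULING g24-№1 §B), stub S4
# `firstVariationFibre` (= route-R stub S `stub_firstVariationOpt`, OWNER RULING g24-№2): **S REDUCED TO ONE CONSTRAINT-VELOCITY BOUND** —
# `Lin_U(Y) ≥ −2ε₀L^{−(K−n)}Θ − (4ε₀L^{−3(K−n)} + 2ε₀L^{−(K−n)}κ)·Σ_b‖Y_b‖²` whenever the velocity of the `(K−n)`-fold (0.4)-average along `s ↦ e^{s·log(1+Y)}U` has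
# `ℓ¹` norm `≤ κ·Σ_b‖Y_b‖² + Θ` (`Θ` free: e.g. a multiple of the relative curvature energy `Σ_p‖R_p − 1‖²` of S's θ-form)

Cell `ym3-torus` ∕ width seat `ym-ust-19200-w1` (gen 0; HUMAN RULING D-0037 — YM₃ on T³ is ladder rung R3, not the Clay problem).

WHY.  Schema (iii) of `Prop7BlendClause1.atMostOneCriticalOrbit_of_reprSchema_T3` (p583914) asks, for an R2-critical `U ∈ 𝔘_k(ε₀) ∩ 𝔅_k(V)` and a
representative `W′` of the other critical orbit, `−C_L·Σ_b‖Y_b‖² ≤ Lin_U(Y)`, `Y_b = W′_bU_b^* − 1`, with `C_L < (1/(16C_P))L^{−2(K−n)} − …`.  Steps (i) and (iii)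
of the refined S4 plan are in the tree: `Prop7FirstVariationLog.abs_lin_sub_lin_log_le_T3` (`|Lin(Y) − Lin(X)| ≤ 4ε₀L^{−3k}Σ‖Y‖²`, `X = log(1+Y)`) and
`Prop7FirstVariationMultiplier.abs_lin_le_constraint_velocity` (`|Lin(X)| ≤ 2ε₀L^{−k}·Σ_c‖D_c‖`, `D_c` the velocity of the `k`-fold average along any family
with velocities `X_bU(b)`).  This file records the resulting REDUCTION: S4 with `C_L = 4ε₀L^{−3k} + 2ε₀L^{−k}κ` (plus `−2ε₀L^{−k}Θ`) follows from the single bound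
(CV) `Σ_c‖D_c‖ ≤ κ·Σ_b‖Y_b‖² + Θ`; with `Θ := (L^{K−n}/(8ε₀))·Σ_p‖R_p − 1‖²` the conclusion is EXACTLY the θ-form of route-R's registered stub S
(`−¼Σ_p‖R_p−1‖² − C_Sε₀L^{−2(K−n)}Σ‖Y‖² ≤ Lin_U(Y)`, `Lines/birth_routeR.lean`) once `κ = c·L^{−(K−n)}` — so the curl-ful part of a competitor is cheap in (CV) and only
its curl-free part needs the delicate `κ`.  HONEST READING OF (CV): the schema needs `κ = c·L^{−(K−n)}` (then `C_L = O(ε₀L^{−2k})`); the velocity `D = TX` is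
second-order small because `e^{X}U = W′` lies in the fibre (`Ū^{(k)}(e^{sX}U) = V` at `s = 0` AND `s = 1`), but the second-order functional carries the
path multiplicities of (0.4) (`≤ L^{3k}` on the spines of the block centres), so WITHOUT a sup-vs-ℓ² regularity input on the representative ((R) of
CARD-19200-V3-g9 §8) only `κ = O(L^{+k})` is available — the remaining analytic kernel of clause 1 on this line is exactly (CV) at `κ = cL^{−k}` for
critical pairs.

WHAT IS PROVED (sorry-free, no definition).  **`lin_ge_neg_of_constraintVelocity`** (the title reduction, at the d = 3 carriers, for an abstract family `Γ₀`
through `U` with velocities `log(1 + Y_b)U(b)` — e.g. `s ↦ e^{s·log(1+Y_b)}U(b)`, which reaches `W′` at `s = 1` by `Prop7FirstVariationLog.exp_mlog_one_add_mul`).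

HONEST SCOPE.  Bookkeeping only ((i) + (iii)); (CV) is the open stub.  Count-neutral helper toward stmt-QuantumFields-19200 (`--supports`); nothing
continuum ∕ OS ∕ mass-gap ∕ Clay.

References: T. Bałaban, CMP **102** (1985) 277–309 [Balaban1985Variational] ((2), (6) p.278, (47)–(48) p.287, (141)–(143) p.299); CMP **99** (1985) 389–434
[Balaban1985BackgroundPropagators] ((3.11) p.392); CMP **98** (1985) 17–51 [Balaban1985Averaging] ((21), (26) pp.21–22).
-/

noncomputable section

open scoped BigOperators Matrix.Norms.L2Operator Matrix Topology
open Filter NormedSpace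

namespace Summit.QuantumFields.YangMills.Theorems.Prop7FirstVariationAssembly

open Literature.MathematicalPhysics.QuantumFieldTheory.Balaban1983to89
open MatrixLog (mlog)
open T4Continuum AveragingRT BlockAveraging BlockAveragingHaarAC BlockAveragingEMLHaarAC ExpMeanLog
open T3ContinuumYM3Torus T3UnitLawDensityEML T3ConstrainedMinimiser T3TiltDescent T3DescentFibreTower
open T3RegularMinimiser T3PrintedRegularMinimiser T3Thm1CarrierNative
open Summit.QuantumFields.YangMills.Theorems.Prop7FirstVariationLog (abs_lin_sub_lin_log_le_T3)
open Summit.QuantumFields.YangMills.Theorems.Prop7FirstVariationMultiplier (abs_lin_le_constraint_velocity)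

variable (F : T3Family) {n K : ℕ}

/-- **S4 ⇐ (CV).**  Let `U₀ ∈ 𝔘_k(ε₀)` be R2-critical in the descent fibre of `V`, `10¹⁰L⁶ε₀ ≤ 1`, `Y` a bond field with `‖Y_b‖ ≤ ½`, `X_b = log(1 + Y_b)`,
and `Γ₀(s)` any bondwise differentiable family of fine `SU(2)` fields through `U₀` with velocities `X_bU₀(b)`.  If the velocity at `s = 0` of the
`(K−n)`-fold (0.4)-average of `Γ₀` has `Σ_c‖D_c‖ ≤ κ·Σ_b‖Y_b‖² + Θ` (the constraint-velocity bound (CV), `Θ` any real), then the first variation of the Wilson action along `Y`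
(schema (iii)'s displayed plaquette sum = route-R stub S's right-hand side) satisfies `−2ε₀L^{−(K−n)}Θ − (4ε₀L^{−3(K−n)} + 2ε₀L^{−(K−n)}κ)·Σ_b‖Y_b‖² ≤ Lin_{U₀}(Y)`.
[cite: Balaban1985Variational, (2), (6) p.278, (141)–(143) p.299; Balaban1985BackgroundPropagators, (3.11) p.392; Balaban1985Averaging, (26) p.22] -/
theorem lin_ge_neg_of_constraintVelocity (hnK : n ≤ K)
    {V : GaugeField (F.P n) 0 (Matrix.specialUnitaryGroup (Fin 2) ℂ)} {U₀ : GaugeField (F.P K) 0 (Matrix.specialUnitaryGroup (Fin 2) ℂ)}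
    (hcrit : IsCritR2 F n K hnK V U₀) {ε₀ : ℝ} (hε₀ : 0 < ε₀) (hε : 10 ^ 10 * (F.L : ℝ) ^ 6 * ε₀ ≤ 1) (hU₀reg : RegPr F n K ε₀ U₀)
    (Y X : PBond (F.P K) 0 → Matrix (Fin 2) (Fin 2) ℂ) (hY : ∀ b : PBond (F.P K) 0, ‖Y b‖ ≤ 1 / 2)
    (hX : ∀ b : PBond (F.P K) 0, X b = mlog (1 + Y b))
    (Γ₀ : ℝ → GaugeField (F.P K) 0 (Matrix.specialUnitaryGroup (Fin 2) ℂ)) (hΓ₀0 : Γ₀ 0 = U₀)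
    (hΓ₀d : ∀ b : PBond (F.P K) 0, HasDerivAt (fun s : ℝ => (Γ₀ s b : Matrix (Fin 2) (Fin 2) ℂ)) (X b * (U₀ b : Matrix (Fin 2) (Fin 2) ℂ)) 0)
    {κ Θ : ℝ} (hκ : ∑ c : PBond (F.P K) (K - n),
        ‖deriv (fun s : ℝ => ((Averaging.iter (fun i => blockAvg (P := F.P K) (j := i) (expMeanLogSU (n := Fin 2))) (K - n) (Γ₀ s) c :
            Matrix.specialUnitaryGroup (Fin 2) ℂ) : Matrix (Fin 2) (Fin 2) ℂ)) 0‖ ≤ κ * ∑ b : PBond (F.P K) 0, ‖Y b‖ ^ 2 + Θ) :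
    -(2 * ε₀ * ((F.L : ℝ) ^ (K - n))⁻¹) * Θ
        - (4 * ε₀ * (((F.L : ℝ) ^ (K - n)) ^ 3)⁻¹ + 2 * ε₀ * ((F.L : ℝ) ^ (K - n))⁻¹ * κ) * ∑ b : PBond (F.P K) 0, ‖Y b‖ ^ 2
      ≤ ∑ p : Plaq (F.P K) 0, (1 / 2) * ((((((GaugeField.plaqHol U₀ p : Matrix.specialUnitaryGroup (Fin 2) ℂ) : Matrix (Fin 2) (Fin 2) ℂ)) - 1)ᴴ
          * ((Y ⟨p.src, p.μ⟩
              + (U₀ ⟨p.src, p.μ⟩ : Matrix (Fin 2) (Fin 2) ℂ) * Y ⟨p.src.shift p.μ, p.ν⟩ * star (U₀ ⟨p.src, p.μ⟩ : Matrix (Fin 2) (Fin 2) ℂ)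
              - ((U₀ ⟨p.src, p.μ⟩ * U₀ ⟨p.src.shift p.μ, p.ν⟩ * (U₀ ⟨p.src.shift p.ν, p.μ⟩)⁻¹ : Matrix.specialUnitaryGroup (Fin 2) ℂ) : Matrix (Fin 2) (Fin 2) ℂ)
                  * Y ⟨p.src.shift p.ν, p.μ⟩
                  * star ((U₀ ⟨p.src, p.μ⟩ * U₀ ⟨p.src.shift p.μ, p.ν⟩ * (U₀ ⟨p.src.shift p.ν, p.μ⟩)⁻¹ : Matrix.specialUnitaryGroup (Fin 2) ℂ) : Matrix (Fin 2) (Fin 2) ℂ)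
              - ((GaugeField.plaqHol U₀ p : Matrix.specialUnitaryGroup (Fin 2) ℂ) : Matrix (Fin 2) (Fin 2) ℂ) * Y ⟨p.src, p.ν⟩
                  * star ((GaugeField.plaqHol U₀ p : Matrix.specialUnitaryGroup (Fin 2) ℂ) : Matrix (Fin 2) (Fin 2) ℂ))
            * ((GaugeField.plaqHol U₀ p : Matrix.specialUnitaryGroup (Fin 2) ℂ) : Matrix (Fin 2) (Fin 2) ℂ))).trace).re := by
  have h1 := abs_lin_sub_lin_log_le_T3 F n K U₀ hU₀reg.2 Y X hY hX
  have h2 := abs_lin_le_constraint_velocity F hnK hcrit hε₀ hε hU₀reg Γ₀ hΓ₀0 X hΓ₀d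
  have hL0 : (0 : ℝ) < F.L := by
    have h : 3 ≤ F.L := by obtain ⟨a, ha⟩ := F.hL.1; have := F.hL.2; omega
    have : (3 : ℝ) ≤ F.L := by exact_mod_cast h
    linarith
  have hc0 : 0 ≤ 2 * ε₀ * ((F.L : ℝ) ^ (K - n))⁻¹ := by positivity
  have h3 : 2 * ε₀ * ((F.L : ℝ) ^ (K - n))⁻¹ * ∑ c : PBond (F.P K) (K - n),
      ‖deriv (fun s : ℝ => ((Averaging.iter (fun i => blockAvg (P := F.P K) (j := i) (expMeanLogSU (n := Fin 2))) (K - n) (Γ₀ s) c :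
          Matrix.specialUnitaryGroup (Fin 2) ℂ) : Matrix (Fin 2) (Fin 2) ℂ)) 0‖
        ≤ 2 * ε₀ * ((F.L : ℝ) ^ (K - n))⁻¹ * (κ * ∑ b : PBond (F.P K) 0, ‖Y b‖ ^ 2 + Θ) := mul_le_mul_of_nonneg_left hκ hc0
  obtain ⟨h1l, h1r⟩ := abs_le.mp h1
  obtain ⟨h2l, h2r⟩ := abs_le.mp h2
  have e : -(2 * ε₀ * ((F.L : ℝ) ^ (K - n))⁻¹) * Θ
        - (4 * ε₀ * (((F.L : ℝ) ^ (K - n)) ^ 3)⁻¹ + 2 * ε₀ * ((F.L : ℝ) ^ (K - n))⁻¹ * κ) * ∑ b : PBond (F.P K) 0, ‖Y b‖ ^ 2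
      = -(4 * ε₀ * (((F.L : ℝ) ^ (K - n)) ^ 3)⁻¹ * ∑ b : PBond (F.P K) 0, ‖Y b‖ ^ 2)
        - 2 * ε₀ * ((F.L : ℝ) ^ (K - n))⁻¹ * (κ * ∑ b : PBond (F.P K) 0, ‖Y b‖ ^ 2 + Θ) := by ring
  rw [e]
  linarith

end Summit.QuantumFields.YangMills.Theorems.Prop7FirstVariationAssembly

end
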